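import Summits.Ventures.Crystal3D.Theorems.StickyWulffConstantTextureLiminfLineCountGlue
import HarnessLib

/-!
# Table re-indexing at fixed `e₃`: the cell for a RE-PRESENTED plate with the constant table gives the cell for the original table
# (lane T, crux `TextureLiminfV5`, stmt-Ventures-23912; cf-p1 DECISION (cii)/(cii′) work item (M), 2026-08-29T04:06:50Z/04:09:13Z)

HONEST FRAMING. Venture `Summits/Ventures/Crystal3D` (cell `crystal3d-full`), route `route-Ventures-StickyWulffConstant`, helper
`--supports` the law-v5 crux `TextureLiminfV5` (stmt-Ventures-23912).  Measure bookkeeping only, standard axioms; nothing about any wall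
law is claimed beyond the stated implications; rung F-C1 not moved.

WHAT ((δ)-fcc, item (M)).  Re-presenting a plate (`stacking L₁′ s₁′ σ₁′ = stacking L₁ s₁ σ₁`, e.g. an fcc plate re-framed by
`exists_fcc_presentation_of_slot`, p695042) changes the bilayer SLABS `laySlab L₁′ s₁′ i` and hence the meaning of a table `c i j`; the
cell inequality `BilayerWallAt` depends on the presentation only through `stacking` (unchanged) and the charge
`Q(c) = Σ′_ij c i j · |S ∩ laySlab L₁ s₁ i ∩ laySlab L₂ s₂ j|`.  Since both slab families partition space up to null planes
(`measure_eq_tsum_inter_laySlab`), the CONSTANT table `c₀` has the same charge `c₀·|S|` in every presentation, and every `c ≤ c₀` has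
`Q(c) ≤ c₀·|S|` (`two_charge_le_const`).  Hence:
* `tsum_const_mul_volume_inter_laySlab₂` — `Σ′_ij c₀·|S ∩ slab_i ∩ slab_j| = c₀·|S|`;
* **`bilayerWallAt_of_represented₁`** / **`…₂`** — `BilayerWallAt C R₀ σ₁′ σ₂ L₁′ L₂ s₁′ s₂ (fun _ _ => c₀)` for a re-presentation of
  plate 1 (resp. plate 2) implies `BilayerWallAt C R₀ σ₁ σ₂ L₁ L₂ s₁ s₂ c` for every table `0 ≤ c ≤ c₀` (caps survive, as (cii) says);
* `const_le_chosenFlux_of_steep` — the constant table `c₀` is dominated by half the chosen flux of an fcc presentation whose slot rises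
  `≥ √2·c₀` (the `hdom` input of `bilayerWallAt_of_K1a_at`, p693671, for `σ = constHagg`).
So the (δ)-fcc chain reads: criterion `∃ w ∈ fccSlots, √2·c₀ ≤ ⟪A w, e₃⟫` ⟶ `exists_fcc_presentation_steep` ⟶ K1a-at on the
re-presented frame with the constant table ⟶ `bilayerWallAt_of_represented₁` ⟶ the cell for the original table.
WHAT THIS IS NOT: no proof of any wall law or of any registered stub; F-C1 not moved.
-/

noncomputable section

namespace Summit.Ventures.Crystal3D.Theorems

open MeasureTheory Set
open scoped ENNReal InnerProductSpace
open Literature.MathematicalPhysics.StatisticalMechanics (IsHaggSeq constHagg)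
open Summit.Ventures.Crystal3D.Cruxes.TextureLiminf.TexShadow (E3 e₃ cyl stacking laySlab bilayerRise BilayerWallAt)

/-! ## The constant table has presentation-independent charge -/

/-- **`Σ′_ij a·|S ∩ slab_i ∩ slab_j| = a·|S|`**: the two slab families partition a measurable set of finite volume up to null planes. -/
theorem tsum_const_mul_volume_inter_laySlab₂ (L₁ L₂ : E3 ≃ₗᵢ[ℝ] E3) (s₁ s₂ : E3) (a : ℝ) (S : Set E3) (hS : MeasurableSet S)
    (hSfin : volume S ≠ ⊤) :
    ∑' ij : ℤ × ℤ, a * (volume (S ∩ laySlab L₁ s₁ ij.1 ∩ laySlab L₂ s₂ ij.2)).toReal = a * (volume S).toReal := by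
  have hE : ∑' ij : ℤ × ℤ, volume (S ∩ laySlab L₁ s₁ ij.1 ∩ laySlab L₂ s₂ ij.2) = volume S := by
    rw [show (∑' ij : ℤ × ℤ, volume (S ∩ laySlab L₁ s₁ ij.1 ∩ laySlab L₂ s₂ ij.2)) =
        ∑' i : ℤ, ∑' j : ℤ, volume (S ∩ laySlab L₁ s₁ i ∩ laySlab L₂ s₂ j) from
        ENNReal.tsum_prod (f := fun i j => volume (S ∩ laySlab L₁ s₁ i ∩ laySlab L₂ s₂ j)),
      measure_eq_tsum_inter_laySlab L₁ s₁ S hS]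
    refine tsum_congr fun i => ?_
    rw [measure_eq_tsum_inter_laySlab L₂ s₂ (S ∩ laySlab L₁ s₁ i) (hS.inter (measurableSet_laySlab L₁ s₁ i))]
  have hfin : ∀ ij : ℤ × ℤ, volume (S ∩ laySlab L₁ s₁ ij.1 ∩ laySlab L₂ s₂ ij.2) ≠ ⊤ := fun ij =>
    ne_top_of_le_ne_top hSfin (measure_mono (Set.inter_subset_left.trans Set.inter_subset_left))
  rw [tsum_mul_left, ← ENNReal.tsum_toReal_eq hfin, hE]

/-! ## Re-presentation of plate 1 / plate 2 -/

/-- **Re-indexing, plate 1.**  If `(L₁′, s₁′, σ₁′)` presents the same plate as `(L₁, s₁, σ₁)` and the cell inequality holds in that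
presentation for the CONSTANT table `c₀`, then it holds in the original presentation for every table `0 ≤ c ≤ c₀`. -/
theorem bilayerWallAt_of_represented₁ {C R₀ c₀ : ℝ} (hR₀ : 0 ≤ R₀) {σ₁ σ₁' σ₂ : ℤ → ℤ}
    {L₁ L₁' L₂ : E3 ≃ₗᵢ[ℝ] E3} {s₁ s₁' s₂ : E3} (hst : stacking L₁' s₁' σ₁' = stacking L₁ s₁ σ₁)
    (hW : BilayerWallAt C R₀ σ₁' σ₂ L₁' L₂ s₁' s₂ (fun _ _ => c₀))
    {c : ℤ → ℤ → ℝ} (hc0 : ∀ i j, 0 ≤ c i j) (hcB : ∀ i j, c i j ≤ c₀) :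
    BilayerWallAt C R₀ σ₁ σ₂ L₁ L₂ s₁ s₂ c := by
  intro h hh ρ hρ X P₁ P₂ hX hP₁ hP₂ hcyl hP₁def hP₂def
  have hP₁def' : ∀ p, p ∈ P₁ ↔
      (p ∈ stacking L₁' s₁' σ₁' ∧ -(2 * R₀) ≤ p 2 ∧ p 2 ≤ -R₀ ∧ p 0 ^ 2 + p 1 ^ 2 ≤ ρ ^ 2) := by
    rw [hst]; exact hP₁def
  have key := hW h hh ρ hρ X P₁ P₂ hX hP₁ hP₂ hcyl hP₁def' hP₂def
  rw [hst] at key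
  have hρ0 : 0 ≤ ρ := hR₀.trans hρ
  have hset : ({q : E3 | 0 ≤ q 2 ∧ q 2 ≤ 1 ∧ q 0 ^ 2 + q 1 ^ 2 ≤ ρ ^ 2} : Set E3) = wallSlice ρ := rfl
  rw [hset] at key ⊢
  have hSfin : volume (wallSlice ρ) ≠ ⊤ := by rw [volume_wallSlice ρ hρ0]; exact ENNReal.ofReal_ne_top
  have hQ' := tsum_const_mul_volume_inter_laySlab₂ L₁' L₂ s₁' s₂ c₀ (wallSlice ρ) (measurableSet_wallSlice ρ) hSfin
  have hQ := two_charge_le_const L₁ L₂ s₁ s₂ c c₀ hc0 hcB (wallSlice ρ) (measurableSet_wallSlice ρ) hSfin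
  beta_reduce at key
  rw [hQ'] at key
  linarith

/-- **Re-indexing, plate 2** (the twin: `(L₂′, s₂′, σ₂′)` presents the same plate as `(L₂, s₂, σ₂)`). -/
theorem bilayerWallAt_of_represented₂ {C R₀ c₀ : ℝ} (hR₀ : 0 ≤ R₀) {σ₁ σ₂ σ₂' : ℤ → ℤ}
    {L₁ L₂ L₂' : E3 ≃ₗᵢ[ℝ] E3} {s₁ s₂ s₂' : E3} (hst : stacking L₂' s₂' σ₂' = stacking L₂ s₂ σ₂)
    (hW : BilayerWallAt C R₀ σ₁ σ₂' L₁ L₂' s₁ s₂' (fun _ _ => c₀))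
    {c : ℤ → ℤ → ℝ} (hc0 : ∀ i j, 0 ≤ c i j) (hcB : ∀ i j, c i j ≤ c₀) :
    BilayerWallAt C R₀ σ₁ σ₂ L₁ L₂ s₁ s₂ c := by
  intro h hh ρ hρ X P₁ P₂ hX hP₁ hP₂ hcyl hP₁def hP₂def
  have hP₂def' : ∀ p, p ∈ P₂ ↔
      (p ∈ stacking L₂' s₂' σ₂' ∧ h + R₀ ≤ p 2 ∧ p 2 ≤ h + 2 * R₀ ∧ p 0 ^ 2 + p 1 ^ 2 ≤ ρ ^ 2) := by
    rw [hst]; exact hP₂def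
  have key := hW h hh ρ hρ X P₁ P₂ hX hP₁ hP₂ hcyl hP₁def hP₂def'
  rw [hst] at key
  have hρ0 : 0 ≤ ρ := hR₀.trans hρ
  have hset : ({q : E3 | 0 ≤ q 2 ∧ q 2 ≤ 1 ∧ q 0 ^ 2 + q 1 ^ 2 ≤ ρ ^ 2} : Set E3) = wallSlice ρ := rfl
  rw [hset] at key ⊢
  have hSfin : volume (wallSlice ρ) ≠ ⊤ := by rw [volume_wallSlice ρ hρ0]; exact ENNReal.ofReal_ne_top
  have hQ' := tsum_const_mul_volume_inter_laySlab₂ L₁ L₂' s₁ s₂' c₀ (wallSlice ρ) (measurableSet_wallSlice ρ) hSfin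
  have hQ := two_charge_le_const L₁ L₂ s₁ s₂ c c₀ hc0 hcB (wallSlice ρ) (measurableSet_wallSlice ρ) hSfin
  beta_reduce at key
  rw [hQ'] at key
  linarith

/-! ## The constant table is dominated by the chosen flux of a steep fcc presentation -/

/-- For an fcc presentation (`σ = constHagg`, every bilayer is a Δ-bilayer) whose chosen slot rises `⟪L v, e⟫ ≥ √2·c₀`, the constant
table `c₀` satisfies the `hdom` hypothesis of `bilayerWallAt_of_K1a_at` / `_top_at`:
`c₀ ≤ √2·(if constHagg i = 1 then ⟪L v, e⟫ else bilayerRise L constHagg e i)/2`. -/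
theorem const_le_chosenFlux_of_steep {c₀ : ℝ} {L : E3 ≃ₗᵢ[ℝ] E3} {v e : E3} (hsteep : Real.sqrt 2 * c₀ ≤ ⟪L v, e⟫_ℝ)
    (i : ℤ) : c₀ ≤ Real.sqrt 2 * (if constHagg i = 1 then ⟪L v, e⟫_ℝ else bilayerRise L constHagg e i) / 2 := by
  have h1 : constHagg i = 1 := rfl
  rw [if_pos h1]
  have h2 : Real.sqrt 2 * Real.sqrt 2 = 2 := Real.mul_self_sqrt (by norm_num)
  have hs2 : 0 ≤ Real.sqrt 2 := Real.sqrt_nonneg 2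
  have h3 : 2 * c₀ ≤ Real.sqrt 2 * ⟪L v, e⟫_ℝ := by
    have := mul_le_mul_of_nonneg_left hsteep hs2
    rw [← mul_assoc, h2] at this
    exact this
  linarith

end Summit.Ventures.Crystal3D.Theorems

end
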